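import Literature.Analysis.UnboundedOperators.MildFlowDerivativesResolvent
import Literature.Analysis.UnboundedOperators.SemilinearMildFlow
import HarnessLib

/-!
# Smooth dependence of mild solutions on the datum as curves in `C([0, L]; E)`; first and second
# variation

Analysis/UnboundedOperators support file (theorems only, everything proved, no named facts, no
definitions).  Setting: a real Banach space `E`, strongly continuous contractions `T(t)` (`t ≥ 0`),
bounded operators `K(t)` (`t > 0`), strongly continuous on `(0, ∞)` with the weakly singular bound
`‖K(t)‖ ≤ C t^{-α}`, `0 ≤ α < 1` (the abstract `e^{-tA}`, `A^α e^{-tA}` of D. Henry, *Geometric Theory of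
Semilinear Parabolic Equations*, LNM 840 (1981), Thm 1.4.3), a bounded bilinear `N`, a constant forcing
`f`, a horizon `L > 0`, and a family `G : E → C([0, L]; E)` of **mild solutions**,

  `G y (t) = T(t) y + ∫₀ᵗ T(t − s) f ds − ∫₀ᵗ K(t − s) N(G y (s), G y (s)) ds`     (`y ∈ U`, `0 ≤ t ≤ L`),

indexed by the data `y` of an open set `U ⊆ E` and **continuous** on `U` into `X = C([0, L]; E)` (as
produced along a compact set of data by the tube theorem, `exists_open_mildFlow_of_isCompact`).

* `contDiffOn_of_mild` — **`G` is `C^∞` on `U` as a map into `X`** (Henry 1981, Thm 3.4.4).  Proof = Henry's: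
  with the orbit map `A`, the forcing curve `F₀`, the Duhamel operator `Φ` and the Nemytskii map `B` of
  `SemilinearMildFlowOperators.lean` / `WeaklySingularDuhamel.lean` the mild identity reads
  `Ψ(y, G y) = 0`, `Ψ(y, w) = w − (A y + F₀ − Q w w)`, `Q y z = Φ (B y z)` (`eq_picard_of_mild`); `Ψ` is a
  continuous polynomial, and `∂_w Ψ(y₀, G y₀) = 1 + P`, `P w = Q (G y₀) w + Q w (G y₀)`, is the linearised
  Volterra operator `(P w)(t) = ∫₀ᵗ K(t − s) (N(y(s), w(s)) + N(w(s), y(s))) ds`, invertible by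
  `isInvertible_one_add_of_eq_duhamel` (`MildFlowDerivativesResolvent.lean`, Henry's Lemma 7.1.1); the
  implicit function theorem with a continuous branch
  (`Literature.Analysis.Calculus.contDiffAt_of_implicitZero'`) identifies `G` near `y₀` with the `C^∞`
  implicit function (`contDiffOn_of_eq_picard`).
* `fderiv_eq_of_eq_picard`, `fderiv_mildFlow_apply` — **first variation** (Henry 1981, Cor. 3.4.6):
  `DG(y) h = A h − (Q (G y) (DG(y) h) + Q (DG(y) h) (G y))`, i.e.
  `w(t) = T(t) h − ∫₀ᵗ K(t − s) (N(y(s), w(s)) + N(w(s), y(s))) ds` for `w = DG(y) h`, `y = G y`;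
* `fderiv_fderiv_eq_of_eq_picard`, `fderiv_fderiv_mildFlow_apply` — **second variation**:
  `v = D²G(y)[k] h` solves `v(t) = −∫₀ᵗ K(t − s) (N(w_k, w_h) + N(y, v) + N(v, y) + N(w_h, w_k))(s) ds`
  (differentiate the first variation once more; chain rule for bounded bilinear maps).

The joint continuity of these derivatives in `(t, y)` in operator norm is the sibling
`MildFlowDerivatives.lean`.

## References

* D. Henry, *Geometric Theory of Semilinear Parabolic Equations*, LNM 840, Springer (1981), Thm 1.4.3,
  Lemma 3.3.2, Thm 3.4.4, Cor. 3.4.6, Lemma 7.1.1. [Henry1981]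
* A. Pazy, *Semigroups of Linear Operators and Applications to Partial Differential Equations*,
  Springer (1983), §6.3, Thm 6.3.1. [Pazy1983]
-/

noncomputable section

open MeasureTheory Set Filter intervalIntegral
open _root_.Topology
open scoped ContDiff

namespace Literature.Analysis.UnboundedOperators

variable {E : Type*} [NormedAddCommGroup E] [NormedSpace ℝ E]

/-! ### The mild identity as a fixed-point identity in `C([0, L]; E)` -/

/-- **The mild identity in operator form**: with the orbit map `A y = T(·) y`, the forcing curve
`F₀ = ∫₀ T(· − s) f ds`, the Duhamel operator `(Φ G)(t) = ∫₀ᵗ K(t − s) G(s) ds` and the Nemytskii map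
`(B y z)(t) = N(y(t), z(t))` on `X = C([0, L]; E)`, a curve `z` solving
`z(t) = T(t) x + ∫₀ᵗ T(t − s) f ds − ∫₀ᵗ K(t − s) N(z(s), z(s)) ds` satisfies `z = A x + F₀ − Q z z`,
`Q y z = Φ (B y z)` (Henry 1981, §3.3; Pazy 1983, §6.3, the map `F` of Thm 6.3.1). [folklore] -/
theorem eq_picard_of_mild {T K : ℝ → E →L[ℝ] E} {N : E →L[ℝ] E →L[ℝ] E} {f : E} {L : ℝ} (hL : 0 ≤ L)
    {A : E →L[ℝ] C(Icc (0 : ℝ) L, E)} (hA : ∀ (y : E) (t : Icc (0 : ℝ) L), A y t = T t y)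
    {F₀ : C(Icc (0 : ℝ) L, E)} (hF₀ : ∀ t : Icc (0 : ℝ) L, F₀ t = ∫ s in (0 : ℝ)..(t : ℝ), T ((t : ℝ) - s) f)
    {Φ : C(Icc (0 : ℝ) L, E) →L[ℝ] C(Icc (0 : ℝ) L, E)}
    (hΦ : ∀ (g : C(Icc (0 : ℝ) L, E)) (t : Icc (0 : ℝ) L),
      Φ g t = ∫ s in (0 : ℝ)..(t : ℝ), K ((t : ℝ) - s) (g (Set.projIcc 0 L hL s)))
    {B Q : C(Icc (0 : ℝ) L, E) →L[ℝ] C(Icc (0 : ℝ) L, E) →L[ℝ] C(Icc (0 : ℝ) L, E)}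
    (hB : ∀ (y z : C(Icc (0 : ℝ) L, E)) (t : Icc (0 : ℝ) L), B y z t = N (y t) (z t))
    (hQ : ∀ y z, Q y z = Φ (B y z)) {x : E} {z : C(Icc (0 : ℝ) L, E)}
    (hz : ∀ t : Icc (0 : ℝ) L, z t = T t x + (∫ s in (0 : ℝ)..(t : ℝ), T ((t : ℝ) - s) f) -
      ∫ s in (0 : ℝ)..(t : ℝ), K ((t : ℝ) - s) (N (z (Set.projIcc 0 L hL s)) (z (Set.projIcc 0 L hL s)))) :
    z = A x + F₀ - Q z z := by
  ext t
  rw [ContinuousMap.sub_apply, ContinuousMap.add_apply, hA, hF₀, hQ, hΦ, hz t]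
  simp only [hB]

variable [CompleteSpace E]

/-! ### Smoothness of a continuous family of solutions of `w = A y + F₀ − Q w w` -/

/-- **A continuous family of mild solutions is `C^∞` in the datum as curves** (Henry 1981, Thm 3.4.4,
operator form).  Let `‖K(t)‖ ≤ C t^{-α}` (`C ≥ 0`, `0 ≤ α < 1`), `(Φ g)(t) = ∫₀ᵗ K(t − s) g(s) ds` and
`(B y z)(t) = N(y(t), z(t))` on `X = C([0, L]; E)`, `Q y z = Φ (B y z)`, `A : E →L X`, `F₀ ∈ X`.  If
`G : E → X` is continuous on an open `U` and `G y = A y + F₀ − Q (G y) (G y)` for `y ∈ U`, then `G` is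
`C^∞` on `U`: implicit function theorem for `Ψ(y, w) = w − (A y + F₀ − Q w w)`, whose partial derivative
`1 + Q (G y₀) · + Q · (G y₀)` is the invertible linearised Volterra operator
(`isInvertible_one_add_of_eq_duhamel`), the continuous branch `G` being the implicit function
(`Literature.Analysis.Calculus.contDiffAt_of_implicitZero'`). [cite: Henry1981, Thm 3.4.4] -/
theorem contDiffOn_of_eq_picard {K : ℝ → E →L[ℝ] E} {α C : ℝ} (hα₀ : 0 ≤ α) (hα : α < 1) (hC : 0 ≤ C)
    (hK : ∀ t, 0 < t → ‖K t‖ ≤ C * t ^ (-α)) (N : E →L[ℝ] E →L[ℝ] E) {L : ℝ} (hL : 0 < L)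
    (A : E →L[ℝ] C(Icc (0 : ℝ) L, E)) (F₀ : C(Icc (0 : ℝ) L, E))
    {Φ : C(Icc (0 : ℝ) L, E) →L[ℝ] C(Icc (0 : ℝ) L, E)}
    (hΦ : ∀ (g : C(Icc (0 : ℝ) L, E)) (t : Icc (0 : ℝ) L),
      Φ g t = ∫ s in (0 : ℝ)..(t : ℝ), K ((t : ℝ) - s) (g (Set.projIcc 0 L hL.le s)))
    {B Q : C(Icc (0 : ℝ) L, E) →L[ℝ] C(Icc (0 : ℝ) L, E) →L[ℝ] C(Icc (0 : ℝ) L, E)}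
    (hB : ∀ (y z : C(Icc (0 : ℝ) L, E)) (t : Icc (0 : ℝ) L), B y z t = N (y t) (z t))
    (hQ : ∀ y z, Q y z = Φ (B y z)) {U : Set E} (hU : IsOpen U) {G : E → C(Icc (0 : ℝ) L, E)}
    (hGc : ContinuousOn G U) (hGfix : ∀ y ∈ U, G y = A y + F₀ - Q (G y) (G y)) :
    ContDiffOn ℝ ∞ G U := by
  intro y₀ hy₀
  -- ### the map `Ψ (y, w) = w − (A y + F₀ − Q w w)` and its partial derivative `1 + P` at `(y₀, G y₀)`
  set Ψ : E × C(Icc (0 : ℝ) L, E) → C(Icc (0 : ℝ) L, E) := fun q => q.2 - (A q.1 + F₀ - Q q.2 q.2)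
    with hΨ
  have hΨs : ContDiff ℝ ∞ Ψ :=
    contDiff_snd.sub (((A.contDiff.comp contDiff_fst).add contDiff_const).sub
      (Q.isBoundedBilinearMap.contDiff.comp (contDiff_snd.prodMk contDiff_snd)))
  set P : C(Icc (0 : ℝ) L, E) →L[ℝ] C(Icc (0 : ℝ) L, E) := Q (G y₀) + Q.flip (G y₀) with hP
  have hΨd : HasFDerivAt Ψ (ContinuousLinearMap.snd ℝ E C(Icc (0 : ℝ) L, E) -
      (A.comp (ContinuousLinearMap.fst ℝ E C(Icc (0 : ℝ) L, E)) -
        ((Q (G y₀)).comp (ContinuousLinearMap.snd ℝ E C(Icc (0 : ℝ) L, E)) +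
          (Q.comp (ContinuousLinearMap.snd ℝ E C(Icc (0 : ℝ) L, E))).flip (G y₀)))) (y₀, G y₀) :=
    (ContinuousLinearMap.snd ℝ E C(Icc (0 : ℝ) L, E)).hasFDerivAt.sub
      (Literature.Analysis.Calculus.hasFDerivAt_quadraticPicard A F₀ Q (y₀, G y₀))
  have hPeq : fderiv ℝ Ψ (y₀, G y₀) ∘L ContinuousLinearMap.inr ℝ E C(Icc (0 : ℝ) L, E) = 1 + P := by
    rw [hΨd.fderiv]
    ext w t
    simp only [hP, ContinuousLinearMap.comp_apply, ContinuousLinearMap.inr_apply, sub_apply, add_apply,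
      ContinuousLinearMap.coe_snd', ContinuousLinearMap.coe_fst', ContinuousLinearMap.flip_apply,
      map_zero, zero_sub, one_apply_eq_self, sub_neg_eq_add, ContinuousMap.add_apply]
  -- ### `1 + P` is invertible: `P` is the linearised Volterra operator along `G y₀`
  have hPap : ∀ (w : C(Icc (0 : ℝ) L, E)) (t : Icc (0 : ℝ) L), P w t =
      ∫ s in (0 : ℝ)..(t : ℝ), K ((t : ℝ) - s) ((N (G y₀ (Set.projIcc 0 L hL.le s)) +
        N.flip (G y₀ (Set.projIcc 0 L hL.le s))) (w (Set.projIcc 0 L hL.le s))) := by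
    intro w t
    rw [hP, add_apply, ContinuousLinearMap.flip_apply, hQ, hQ, ← map_add, hΦ]
    refine intervalIntegral.integral_congr fun s _ => ?_
    simp only [ContinuousMap.add_apply, hB, add_apply, ContinuousLinearMap.flip_apply]
  have hBb : ∀ s, ‖N (G y₀ (Set.projIcc 0 L hL.le s)) + N.flip (G y₀ (Set.projIcc 0 L hL.le s))‖ ≤
      2 * ‖N‖ * ‖G y₀‖ := fun s =>
    calc ‖N (G y₀ (Set.projIcc 0 L hL.le s)) + N.flip (G y₀ (Set.projIcc 0 L hL.le s))‖
        ≤ ‖N (G y₀ (Set.projIcc 0 L hL.le s))‖ + ‖N.flip (G y₀ (Set.projIcc 0 L hL.le s))‖ :=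
          norm_add_le _ _
      _ ≤ ‖N‖ * ‖G y₀‖ + ‖N‖ * ‖G y₀‖ := by
          refine add_le_add ((N.le_opNorm _).trans ?_) ((N.flip.le_opNorm _).trans ?_)
          · exact mul_le_mul_of_nonneg_left ((G y₀).norm_coe_le_norm _) (norm_nonneg N)
          · rw [ContinuousLinearMap.opNorm_flip]
            exact mul_le_mul_of_nonneg_left ((G y₀).norm_coe_le_norm _) (norm_nonneg N)
      _ = 2 * ‖N‖ * ‖G y₀‖ := by ring
  have hinv : (fderiv ℝ Ψ (y₀, G y₀) ∘L ContinuousLinearMap.inr ℝ E C(Icc (0 : ℝ) L, E)).IsInvertible := by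
    rw [hPeq]
    exact isInvertible_one_add_of_eq_duhamel hL hα₀ hα hC hK hBb hPap
  -- ### the implicit function theorem with the continuous branch `G`
  have hzero : ∀ᶠ y in 𝓝 y₀, Ψ (y, G y) = Ψ (y₀, G y₀) := by
    have h0 : ∀ y ∈ U, Ψ (y, G y) = 0 := fun y hy => by
      simp only [hΨ]
      rw [← hGfix y hy, sub_self]
    filter_upwards [hU.mem_nhds hy₀] with y hy
    rw [h0 y hy, h0 y₀ hy₀]
  exact (Literature.Analysis.Calculus.contDiffAt_of_implicitZero' (by simp) hΨs.contDiffAt hinv hzero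
    (hGc.continuousAt (hU.mem_nhds hy₀))).contDiffWithinAt

/-! ### First and second variation in operator form -/

omit [CompleteSpace E] in
/-- **First variation in operator form** (Henry 1981, Cor. 3.4.6): if `G` is `C^∞` on the open `U` with
`G y = A y + F₀ − Q (G y) (G y)` there, then `DG(y) h = A h − (Q (G y) (DG(y) h) + Q (DG(y) h) (G y))`
(chain rule for the bounded bilinear `Q`). [folklore] -/
theorem fderiv_eq_of_eq_picard {X : Type*} [NormedAddCommGroup X] [NormedSpace ℝ X]
    (A : E →L[ℝ] X) (F₀ : X) (Q : X →L[ℝ] X →L[ℝ] X) {U : Set E} (hU : IsOpen U) {G : E → X}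
    (hG : ContDiffOn ℝ ∞ G U) (hGfix : ∀ y ∈ U, G y = A y + F₀ - Q (G y) (G y)) {y : E} (hy : y ∈ U)
    (h : E) : fderiv ℝ G y h = A h - (Q (G y) (fderiv ℝ G y h) + Q (fderiv ℝ G y h) (G y)) := by
  have hsmooth : ContDiffAt ℝ ∞ G y := hG.contDiffAt (hU.mem_nhds hy)
  have hG' : HasFDerivAt G (fderiv ℝ G y) y := (hsmooth.differentiableAt (by simp)).hasFDerivAt
  have hP : HasFDerivAt (fun y' => A y' + F₀ - Q (G y') (G y'))
      (A - ((Q (G y)).comp (fderiv ℝ G y) + (Q.comp (fderiv ℝ G y)).flip (G y))) y := by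
    have hQG : HasFDerivAt (fun y' => Q (G y')) (Q.comp (fderiv ℝ G y)) y := Q.hasFDerivAt.comp y hG'
    exact (A.hasFDerivAt.add_const F₀).sub (hQG.clm_apply hG')
  have hkey : HasFDerivAt G (A - ((Q (G y)).comp (fderiv ℝ G y) + (Q.comp (fderiv ℝ G y)).flip (G y))) y :=
    hP.congr_of_eventuallyEq (by filter_upwards [hU.mem_nhds hy] with y' hy' using hGfix y' hy')
  conv_lhs => rw [hkey.fderiv]
  simp only [sub_apply, add_apply, ContinuousLinearMap.comp_apply, ContinuousLinearMap.flip_apply]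

omit [CompleteSpace E] in
/-- **Second variation in operator form**: under the hypotheses of `fderiv_eq_of_eq_picard`,
`D²G(y)[k] h = −(Q (DG k) (DG h) + Q (G y) (D²G[k] h) + Q (D²G[k] h) (G y) + Q (DG h) (DG k))` —
differentiate the first variation in the direction `k` (chain rule for `Q`; `DG = fderiv G` is
differentiable since `G` is `C^∞`). [folklore] -/
theorem fderiv_fderiv_eq_of_eq_picard {X : Type*} [NormedAddCommGroup X] [NormedSpace ℝ X]
    (A : E →L[ℝ] X) (F₀ : X) (Q : X →L[ℝ] X →L[ℝ] X) {U : Set E} (hU : IsOpen U) {G : E → X}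
    (hG : ContDiffOn ℝ ∞ G U) (hGfix : ∀ y ∈ U, G y = A y + F₀ - Q (G y) (G y)) {y : E} (hy : y ∈ U)
    (k h : E) :
    fderiv ℝ (fderiv ℝ G) y k h = -(Q (fderiv ℝ G y k) (fderiv ℝ G y h) +
      Q (G y) (fderiv ℝ (fderiv ℝ G) y k h) + Q (fderiv ℝ (fderiv ℝ G) y k h) (G y) +
      Q (fderiv ℝ G y h) (fderiv ℝ G y k)) := by
  have hsmooth : ContDiffAt ℝ ∞ G y := hG.contDiffAt (hU.mem_nhds hy)
  have hG' : HasFDerivAt G (fderiv ℝ G y) y := (hsmooth.differentiableAt (by simp)).hasFDerivAt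
  have hD' : HasFDerivAt (fderiv ℝ G) (fderiv ℝ (fderiv ℝ G) y) y :=
    ((hsmooth.fderiv_right (m := ∞) ENat.coe_top_add_one.le).differentiableAt (by simp)).hasFDerivAt
  -- the left-hand side `y' ↦ DG(y') h` and its derivative
  have hDh : HasFDerivAt (fun y' => fderiv ℝ G y' h)
      ((ContinuousLinearMap.apply ℝ X h).comp (fderiv ℝ (fderiv ℝ G) y)) y :=
    (ContinuousLinearMap.apply ℝ X h).hasFDerivAt.comp y hD'
  -- the right-hand side and its derivative
  have hQG : HasFDerivAt (fun y' => Q (G y')) (Q.comp (fderiv ℝ G y)) y := Q.hasFDerivAt.comp y hG'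
  have hQD : HasFDerivAt (fun y' => Q (fderiv ℝ G y' h))
      (Q.comp ((ContinuousLinearMap.apply ℝ X h).comp (fderiv ℝ (fderiv ℝ G) y))) y :=
    Q.hasFDerivAt.comp y hDh
  have hR : HasFDerivAt (fun y' => A h - (Q (G y') (fderiv ℝ G y' h) + Q (fderiv ℝ G y' h) (G y')))
      ((0 : E →L[ℝ] X) -
        (((Q (G y)).comp ((ContinuousLinearMap.apply ℝ X h).comp (fderiv ℝ (fderiv ℝ G) y)) +
            (Q.comp (fderiv ℝ G y)).flip (fderiv ℝ G y h)) +
          ((Q (fderiv ℝ G y h)).comp (fderiv ℝ G y) +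
            (Q.comp ((ContinuousLinearMap.apply ℝ X h).comp (fderiv ℝ (fderiv ℝ G) y))).flip (G y))))
      y :=
    (hasFDerivAt_const (A h) y).sub ((hQG.clm_apply hDh).add (hQD.clm_apply hG'))
  -- the two sides agree near `y` (first variation), hence so do their derivatives
  have heq : (fun y' => fderiv ℝ G y' h) =ᶠ[𝓝 y]
      fun y' => A h - (Q (G y') (fderiv ℝ G y' h) + Q (fderiv ℝ G y' h) (G y')) := by
    filter_upwards [hU.mem_nhds hy] with y' hy' using fderiv_eq_of_eq_picard A F₀ Q hU hG hGfix hy' h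
  have h3 := congrArg (fun Z : E →L[ℝ] X => Z k) (hDh.fderiv.symm.trans (heq.fderiv_eq.trans hR.fderiv))
  simp only [ContinuousLinearMap.comp_apply, ContinuousLinearMap.apply_apply, add_apply, neg_apply,
    ContinuousLinearMap.flip_apply, zero_sub] at h3
  refine h3.trans ?_
  abel

/-! ### The intrinsic statements -/

/-- **Mild solutions depend smoothly on the datum as curves** (Henry 1981, Thm 3.4.4).  Let `T(t)` be
strongly continuous contractions, `K(t)` strongly continuous on `(0, ∞)` with `‖K(t)‖ ≤ C t^{-α}`
(`C ≥ 0`, `0 ≤ α < 1`), `N` bounded bilinear, `f ∈ E`, `L > 0`, and `G : E → C([0, L]; E)` continuous on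
an open `U` with `G y` a mild solution from `y` on `[0, L]` for every `y ∈ U`.  Then `G` is `C^∞` on `U`
as a map into the Banach space `C([0, L]; E)`. [cite: Henry1981, Thm 3.4.4] -/
theorem contDiffOn_of_mild (T K : ℝ → E →L[ℝ] E) (hTnorm : ∀ t, 0 ≤ t → ‖T t‖ ≤ 1)
    (hTc : ∀ y : E, Continuous fun t : ℝ => T t y) {α C : ℝ} (hα₀ : 0 ≤ α) (hα : α < 1) (hC : 0 ≤ C)
    (hK : ∀ t, 0 < t → ‖K t‖ ≤ C * t ^ (-α)) (hKc : ∀ y : E, ContinuousOn (fun t : ℝ => K t y) (Ioi 0))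
    (N : E →L[ℝ] E →L[ℝ] E) (f : E) {L : ℝ} (hL : 0 < L) {U : Set E} (hU : IsOpen U)
    {G : E → C(Icc (0 : ℝ) L, E)} (hGc : ContinuousOn G U)
    (hGm : ∀ y ∈ U, ∀ t : Icc (0 : ℝ) L, G y t = T t y + (∫ s in (0 : ℝ)..(t : ℝ), T ((t : ℝ) - s) f) -
      ∫ s in (0 : ℝ)..(t : ℝ), K ((t : ℝ) - s)
        (N (G y (Set.projIcc 0 L hL.le s)) (G y (Set.projIcc 0 L hL.le s)))) :
    ContDiffOn ℝ ∞ G U := by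
  obtain ⟨A, hA, -⟩ := exists_orbitCLM T hTnorm hTc L
  obtain ⟨F₀, hF₀, -⟩ := exists_forcingCurve T hTnorm hTc f L
  obtain ⟨B, hB, -⟩ := exists_nemytskiiBilinearCLM (K := Icc (0 : ℝ) L) N
  obtain ⟨Φ, hΦ, -⟩ := exists_duhamelCLM hL hα hC K hK hKc
  set Q : C(Icc (0 : ℝ) L, E) →L[ℝ] C(Icc (0 : ℝ) L, E) →L[ℝ] C(Icc (0 : ℝ) L, E) :=
    (ContinuousLinearMap.compL ℝ C(Icc (0 : ℝ) L, E) C(Icc (0 : ℝ) L, E) C(Icc (0 : ℝ) L, E) Φ).comp B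
    with hQdef
  have hQ : ∀ y z, Q y z = Φ (B y z) := fun y z => rfl
  exact contDiffOn_of_eq_picard hα₀ hα hC hK N hL A F₀ hΦ hB hQ hU hGc fun y hy =>
    eq_picard_of_mild hL.le hA hF₀ hΦ hB hQ (hGm y hy)

/-- **First variation of a smooth family of mild solutions** (Henry 1981, Cor. 3.4.6): in the setting of
`contDiffOn_of_mild`, for `y ∈ U` and `h ∈ E` the curve `w = DG(y) h ∈ C([0, L]; E)` solves the
linearised mild equation `w(t) = T(t) h − ∫₀ᵗ K(t − s) (N(y(s), w(s)) + N(w(s), y(s))) ds` along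
`y = G y`. [cite: Henry1981, Cor 3.4.6] -/
theorem fderiv_mildFlow_apply (T K : ℝ → E →L[ℝ] E) (hTnorm : ∀ t, 0 ≤ t → ‖T t‖ ≤ 1)
    (hTc : ∀ y : E, Continuous fun t : ℝ => T t y) {α C : ℝ} (hα₀ : 0 ≤ α) (hα : α < 1) (hC : 0 ≤ C)
    (hK : ∀ t, 0 < t → ‖K t‖ ≤ C * t ^ (-α)) (hKc : ∀ y : E, ContinuousOn (fun t : ℝ => K t y) (Ioi 0))
    (N : E →L[ℝ] E →L[ℝ] E) (f : E) {L : ℝ} (hL : 0 < L) {U : Set E} (hU : IsOpen U)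
    {G : E → C(Icc (0 : ℝ) L, E)} (hGc : ContinuousOn G U)
    (hGm : ∀ y ∈ U, ∀ t : Icc (0 : ℝ) L, G y t = T t y + (∫ s in (0 : ℝ)..(t : ℝ), T ((t : ℝ) - s) f) -
      ∫ s in (0 : ℝ)..(t : ℝ), K ((t : ℝ) - s)
        (N (G y (Set.projIcc 0 L hL.le s)) (G y (Set.projIcc 0 L hL.le s))))
    {y : E} (hy : y ∈ U) (h : E) (t : Icc (0 : ℝ) L) :
    fderiv ℝ G y h t = T t h - ∫ s in (0 : ℝ)..(t : ℝ), K ((t : ℝ) - s)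
      (N (G y (Set.projIcc 0 L hL.le s)) (fderiv ℝ G y h (Set.projIcc 0 L hL.le s)) +
        N (fderiv ℝ G y h (Set.projIcc 0 L hL.le s)) (G y (Set.projIcc 0 L hL.le s))) := by
  obtain ⟨A, hA, -⟩ := exists_orbitCLM T hTnorm hTc L
  obtain ⟨F₀, hF₀, -⟩ := exists_forcingCurve T hTnorm hTc f L
  obtain ⟨B, hB, -⟩ := exists_nemytskiiBilinearCLM (K := Icc (0 : ℝ) L) N
  obtain ⟨Φ, hΦ, -⟩ := exists_duhamelCLM hL hα hC K hK hKc
  set Q : C(Icc (0 : ℝ) L, E) →L[ℝ] C(Icc (0 : ℝ) L, E) →L[ℝ] C(Icc (0 : ℝ) L, E) :=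
    (ContinuousLinearMap.compL ℝ C(Icc (0 : ℝ) L, E) C(Icc (0 : ℝ) L, E) C(Icc (0 : ℝ) L, E) Φ).comp B
    with hQdef
  have hQ : ∀ y z, Q y z = Φ (B y z) := fun y z => rfl
  have hGfix : ∀ y ∈ U, G y = A y + F₀ - Q (G y) (G y) := fun y hy =>
    eq_picard_of_mild hL.le hA hF₀ hΦ hB hQ (hGm y hy)
  have hG := contDiffOn_of_eq_picard hα₀ hα hC hK N hL A F₀ hΦ hB hQ hU hGc hGfix
  have hdv := congrArg (fun z : C(Icc (0 : ℝ) L, E) => z t) (fderiv_eq_of_eq_picard A F₀ Q hU hG hGfix hy h)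
  rw [hdv, ContinuousMap.sub_apply, hA, hQ, hQ, ← map_add, hΦ]
  simp only [ContinuousMap.add_apply, hB]

/-- **Second variation of a smooth family of mild solutions**: in the setting of `contDiffOn_of_mild`,
for `y ∈ U` and `k, h ∈ E`, with `y = G y`, `w_h = DG(y) h` and `v = D²G(y)[k] h ∈ C([0, L]; E)`,
`v(t) = −∫₀ᵗ K(t − s) (N(w_k(s), w_h(s)) + N(y(s), v(s)) + N(v(s), y(s)) + N(w_h(s), w_k(s))) ds` — the
linearised mild equation with zero datum and the source `N(w_k, w_h) + N(w_h, w_k)` (Henry 1981, proof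
of Thm 3.4.4 / Cor. 3.4.6, second order). [folklore] -/
theorem fderiv_fderiv_mildFlow_apply (T K : ℝ → E →L[ℝ] E) (hTnorm : ∀ t, 0 ≤ t → ‖T t‖ ≤ 1)
    (hTc : ∀ y : E, Continuous fun t : ℝ => T t y) {α C : ℝ} (hα₀ : 0 ≤ α) (hα : α < 1) (hC : 0 ≤ C)
    (hK : ∀ t, 0 < t → ‖K t‖ ≤ C * t ^ (-α)) (hKc : ∀ y : E, ContinuousOn (fun t : ℝ => K t y) (Ioi 0))
    (N : E →L[ℝ] E →L[ℝ] E) (f : E) {L : ℝ} (hL : 0 < L) {U : Set E} (hU : IsOpen U)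
    {G : E → C(Icc (0 : ℝ) L, E)} (hGc : ContinuousOn G U)
    (hGm : ∀ y ∈ U, ∀ t : Icc (0 : ℝ) L, G y t = T t y + (∫ s in (0 : ℝ)..(t : ℝ), T ((t : ℝ) - s) f) -
      ∫ s in (0 : ℝ)..(t : ℝ), K ((t : ℝ) - s)
        (N (G y (Set.projIcc 0 L hL.le s)) (G y (Set.projIcc 0 L hL.le s))))
    {y : E} (hy : y ∈ U) (k h : E) (t : Icc (0 : ℝ) L) :
    fderiv ℝ (fderiv ℝ G) y k h t = -∫ s in (0 : ℝ)..(t : ℝ), K ((t : ℝ) - s)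
      (N (fderiv ℝ G y k (Set.projIcc 0 L hL.le s)) (fderiv ℝ G y h (Set.projIcc 0 L hL.le s)) +
        N (G y (Set.projIcc 0 L hL.le s)) (fderiv ℝ (fderiv ℝ G) y k h (Set.projIcc 0 L hL.le s)) +
        N (fderiv ℝ (fderiv ℝ G) y k h (Set.projIcc 0 L hL.le s)) (G y (Set.projIcc 0 L hL.le s)) +
        N (fderiv ℝ G y h (Set.projIcc 0 L hL.le s)) (fderiv ℝ G y k (Set.projIcc 0 L hL.le s))) := by
  obtain ⟨A, hA, -⟩ := exists_orbitCLM T hTnorm hTc L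
  obtain ⟨F₀, hF₀, -⟩ := exists_forcingCurve T hTnorm hTc f L
  obtain ⟨B, hB, -⟩ := exists_nemytskiiBilinearCLM (K := Icc (0 : ℝ) L) N
  obtain ⟨Φ, hΦ, -⟩ := exists_duhamelCLM hL hα hC K hK hKc
  set Q : C(Icc (0 : ℝ) L, E) →L[ℝ] C(Icc (0 : ℝ) L, E) →L[ℝ] C(Icc (0 : ℝ) L, E) :=
    (ContinuousLinearMap.compL ℝ C(Icc (0 : ℝ) L, E) C(Icc (0 : ℝ) L, E) C(Icc (0 : ℝ) L, E) Φ).comp B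
    with hQdef
  have hQ : ∀ y z, Q y z = Φ (B y z) := fun y z => rfl
  have hGfix : ∀ y ∈ U, G y = A y + F₀ - Q (G y) (G y) := fun y hy =>
    eq_picard_of_mild hL.le hA hF₀ hΦ hB hQ (hGm y hy)
  have hG := contDiffOn_of_eq_picard hα₀ hα hC hK N hL A F₀ hΦ hB hQ hU hGc hGfix
  have hdv := congrArg (fun z : C(Icc (0 : ℝ) L, E) => z t)
    (fderiv_fderiv_eq_of_eq_picard A F₀ Q hU hG hGfix hy k h)
  rw [hdv, ContinuousMap.neg_apply, hQ, hQ, hQ, hQ, ← map_add, ← map_add, ← map_add, hΦ]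
  simp only [ContinuousMap.add_apply, hB]

end Literature.Analysis.UnboundedOperators

end
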